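import Summits.QuantumFields.YangMills.Theorems.ColdStartUniversalityLatticeLangevinCentreCovariance
import Literature.MathematicalPhysics.QuantumFieldTheory.Balaban1983to89.T3CentreSymmetry
import HarnessLib

/-!
# Route `ColdStartUniversality` (LINE 6 «centre-sector reduction», crux K_A1|Γ `NeutralColdStartMixing`
# stmt-QuantumFields-27363): THE SZZ DYNAMICS COMMUTES WITH THE CENTRE TWISTS — law level, Markov semigroup, the twists

Helper file (seat `ym-line-csu-p1`, g14; `--supports stmt-QuantumFields-27363`).  Packaging of the pathwise transfer
`CentreCovariance.isSolution_centreMul` (file `…LatticeLangevinCentreCovariance`) with uniqueness in law from every start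
(`lawUnique_of_start`).  For a flat centre field `c` (values in `{±1} = Z(SU(2))`, trivial plaquette holonomies):

* ★ `map_centreMul_eq` — for ANY solution `V` from `u` and ANY solution `V'` from `c * u` (each on its own probability
  space with its own flat driver): `law(V'_t) = (c * ·)_* law(V_t)` for all `t` (no regular flow needed: `c * V` is
  itself a solution from `c * u` driven by the same noise);
* `transitionKernel_centreMul` — `κ_t (c * x) = (κ_t x).map (c * ·)` for any kernels realising the transition laws;
* ★ `markovTransition_centreMul` — `P_t f (c * x) = P_t (f ∘ (c * ·)) x` for every solution family and measurable `f`;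
  `markovTransition_centreMul_of_invariant` — `P_t` PRESERVES centre-invariant observables (LUMPING: on such
  observables the semigroup descends to configurations modulo the twists); `markovTransition_centreMul_of_odd` —
  `P_t` maps centre-odd observables (`f (c * x) = −f x`) to centre-odd functions;
* §3 the 't Hooft twists ARE flat centre fields: `twist_centre`, `twist_flat` for
  `e ↦ if e.2 = μ ∧ e.1 μ = s then −1 else 1` (every direction `μ`, every slice `s`), hence
  `isSolution_twist` / `markovTransition_twist`.

THEOREMS ONLY, [folklore] ('t Hooft 1979 §2; SZZ arXiv:2204.12737 §3).  RECORD-rung R3 plumbing: no crux, rung or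
summit statement is proved here and the Yang–Mills mass gap is NOT proved.
-/

set_option autoImplicit false

noncomputable section

namespace Summit.QuantumFields.YangMills.Theorems.ColdStartUniversality.CentreCovariance

open MeasureTheory ProbabilityTheory Filter Matrix
open scoped NNReal ENNReal BigOperators
open Literature.Probability.Process Literature.MathematicalPhysics.QuantumFieldTheory
open Literature.MathematicalPhysics.QuantumLattice (fundamentalRep fundamentalLatticeRep)

variable {L : ℕ} [NeZero L]

/-! ## §1 Covariance in law -/

/-- ★★ **Centre covariance in law of the SZZ dynamics.**  For a flat centre field `c`, every start `u`, every solution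
`V` from `u` and every solution `V'` from `c * u` (each on its own probability space in `Type` with its own flat driver,
raw natural filtrations): `law(V'_t) = (c * ·)_* law(V_t)` for all `t`. [cite: tHooft1979Flux, §2] -/
theorem map_centreMul_eq (β' : ℝ) (c : GaugeConfig 3 L (Matrix.specialUnitaryGroup (Fin 2) ℂ))
    (hc : ∀ e, ((c e : Matrix.specialUnitaryGroup (Fin 2) ℂ) : Matrix (Fin 2) (Fin 2) ℂ) = 1 ∨
      ((c e : Matrix.specialUnitaryGroup (Fin 2) ℂ) : Matrix (Fin 2) (Fin 2) ℂ) = -1)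
    (hflat : ∀ (x : Literature.MathematicalPhysics.QuantumFieldTheory.Site 3 L) (i j : Fin 3), i ≠ j →
      plaquetteHolonomy c x i j = 1)
    (u : GaugeConfig 3 L (Matrix.specialUnitaryGroup (Fin 2) ℂ))
    {Ω : Type} {mΩ : MeasurableSpace Ω} {P : Measure Ω} [IsProbabilityMeasure P]
    {W : ℝ≥0 → Ω → (Edge 3 L × NoiseIdx 2 → ℝ)} (hW : IsFlatBrownian W P)
    {V : ℝ≥0 → Ω → GaugeConfig 3 L (Matrix.specialUnitaryGroup (Fin 2) ℂ)}
    (hV0 : ∀ ω, V 0 ω = u)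
    (hV : (latticeLangevinDynamics (fundamentalLatticeRep 2) β').IsSolution (fundamentalRep (Fin 2))
      hW.natFiltration P W V)
    {Ω' : Type} {mΩ' : MeasurableSpace Ω'} {P' : Measure Ω'} [IsProbabilityMeasure P']
    {W' : ℝ≥0 → Ω' → (Edge 3 L × NoiseIdx 2 → ℝ)} (hW' : IsFlatBrownian W' P')
    {V' : ℝ≥0 → Ω' → GaugeConfig 3 L (Matrix.specialUnitaryGroup (Fin 2) ℂ)}
    (hV'0 : ∀ ω, V' 0 ω = c * u)
    (hV' : (latticeLangevinDynamics (fundamentalLatticeRep 2) β').IsSolution (fundamentalRep (Fin 2))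
      hW'.natFiltration P' W' V') (t : ℝ≥0) :
    Measure.map (V' t) P' = (Measure.map (V t) P).map (fun x => c * x) := by
  have hcV := isSolution_centreMul β' c hc hflat hV
  have h2 : Measure.map (V' t) P' = Measure.map (fun ω => c * V t ω) P :=
    lawUnique_of_start β' (c * u) hW' hW hV'0 hV' (fun ω => by simp only [hV0 ω]) hcV t
  have hmV : Measurable (V t) := (hV.adapted t).mono (hW.natFiltration.le t) le_rfl
  rw [h2, Measure.map_map (measurable_centreMul c) hmV]
  rfl

/-- ★ **The transition kernels are centre covariant**: for any family of kernels `κ_t` realising the transition laws of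
the SZZ dynamics (the conclusion of `exists_transitionKernel`), `κ_t (c * x) = (κ_t x).map (c * ·)`. [cite: tHooft1979Flux, §2] -/
theorem transitionKernel_centreMul (β' : ℝ)
    (κ : ℝ≥0 → Kernel (GaugeConfig 3 L (Matrix.specialUnitaryGroup (Fin 2) ℂ))
      (GaugeConfig 3 L (Matrix.specialUnitaryGroup (Fin 2) ℂ)))
    (hκ : ∀ (t : ℝ≥0) (x : GaugeConfig 3 L (Matrix.specialUnitaryGroup (Fin 2) ℂ))
        (Ω : Type) [MeasurableSpace Ω] (P : Measure Ω) [IsProbabilityMeasure P]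
        (W : ℝ≥0 → Ω → (Edge 3 L × NoiseIdx 2 → ℝ)) (hW : IsFlatBrownian W P)
        (U : ℝ≥0 → Ω → GaugeConfig 3 L (Matrix.specialUnitaryGroup (Fin 2) ℂ)),
        (∀ ω, U 0 ω = x) →
        (latticeLangevinDynamics (fundamentalLatticeRep 2) β').IsSolution (fundamentalRep (Fin 2))
          hW.natFiltration P W U →
        κ t x = P.map (U t))
    (c : GaugeConfig 3 L (Matrix.specialUnitaryGroup (Fin 2) ℂ))
    (hc : ∀ e, ((c e : Matrix.specialUnitaryGroup (Fin 2) ℂ) : Matrix (Fin 2) (Fin 2) ℂ) = 1 ∨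
      ((c e : Matrix.specialUnitaryGroup (Fin 2) ℂ) : Matrix (Fin 2) (Fin 2) ℂ) = -1)
    (hflat : ∀ (x : Literature.MathematicalPhysics.QuantumFieldTheory.Site 3 L) (i j : Fin 3), i ≠ j →
      plaquetteHolonomy c x i j = 1)
    (t : ℝ≥0) (x : GaugeConfig 3 L (Matrix.specialUnitaryGroup (Fin 2) ℂ)) :
    κ t (c * x) = (κ t x).map (fun y => c * y) := by
  haveI := isProbabilityMeasure_piWiener (Edge 3 L × NoiseIdx 2)
  have hWc := isFlatBrownian_piWiener 3 L (NoiseIdx 2)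
  obtain ⟨V, hV0, hV⟩ := solution_from_start hWc β' x
  have hcV := isSolution_centreMul β' c hc hflat hV
  rw [hκ t x _ _ _ hWc V hV0 hV, hκ t (c * x) _ _ _ hWc (fun s ω => c * V s ω) (fun ω => by simp only [hV0 ω]) hcV]
  exact map_centreMul_eq β' c hc hflat x hWc hV0 hV hWc (V' := fun s ω => c * V s ω)
    (fun ω => by simp only [hV0 ω]) hcV t

/-! ## §2 The Markov semigroup: covariance, lumping of invariant observables, odd observables -/

section Semigroup

variable (β' : ℝ) {Ω : Type} {mΩ : MeasurableSpace Ω} {P : Measure Ω} [IsProbabilityMeasure P]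
  {W : ℝ≥0 → Ω → (Edge 3 L × NoiseIdx 2 → ℝ)} (hW : IsFlatBrownian W P)
  {U : GaugeConfig 3 L (Matrix.specialUnitaryGroup (Fin 2) ℂ) → ℝ≥0 → Ω →
    GaugeConfig 3 L (Matrix.specialUnitaryGroup (Fin 2) ℂ)}
  (hU : ∀ x, (∀ ω, U x 0 ω = x) ∧
    (latticeLangevinDynamics (fundamentalLatticeRep 2) β').IsSolution (fundamentalRep (Fin 2))
      hW.natFiltration P W (U x))
  (c : GaugeConfig 3 L (Matrix.specialUnitaryGroup (Fin 2) ℂ))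
  (hc : ∀ e, ((c e : Matrix.specialUnitaryGroup (Fin 2) ℂ) : Matrix (Fin 2) (Fin 2) ℂ) = 1 ∨
    ((c e : Matrix.specialUnitaryGroup (Fin 2) ℂ) : Matrix (Fin 2) (Fin 2) ℂ) = -1)
  (hflat : ∀ (x : Literature.MathematicalPhysics.QuantumFieldTheory.Site 3 L) (i j : Fin 3), i ≠ j →
    plaquetteHolonomy c x i j = 1)

include hU hc hflat in
/-- ★ **The Markov semigroup is centre covariant**: for every solution family `(U^x)_x` of the SZZ dynamics on one
probability space (started at every `x`, one flat driver), every measurable `f` and every `t`,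
`P_t f (c * x) = P_t (f ∘ (c * ·)) x`, i.e. `E f(U^{c x}_t) = E f(c U^x_t)`. [cite: tHooft1979Flux, §2] -/
theorem markovTransition_centreMul {f : GaugeConfig 3 L (Matrix.specialUnitaryGroup (Fin 2) ℂ) → ℝ}
    (hf : Measurable f) (t : ℝ≥0) (x : GaugeConfig 3 L (Matrix.specialUnitaryGroup (Fin 2) ℂ)) :
    markovTransition U P t f (c * x) = markovTransition U P t (f ∘ fun y => c * y) x := by
  have hlaw := map_centreMul_eq β' c hc hflat x hW (hU x).1 (hU x).2 hW (hU (c * x)).1 (hU (c * x)).2 t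
  have hm : ∀ y, Measurable (U y t) := fun y => ((hU y).2.adapted t).mono (hW.natFiltration.le t) le_rfl
  unfold markovTransition
  calc ∫ ω, f (U (c * x) t ω) ∂P
      = ∫ v, f v ∂(Measure.map (U (c * x) t) P) :=
        (integral_map (hm _).aemeasurable hf.aestronglyMeasurable).symm
    _ = ∫ v, f v ∂((Measure.map (U x t) P).map (fun y => c * y)) := by rw [hlaw]
    _ = ∫ v, (f ∘ fun y => c * y) v ∂(Measure.map (U x t) P) :=
        integral_map (measurable_centreMul c).aemeasurable hf.aestronglyMeasurable
    _ = ∫ ω, (f ∘ fun y => c * y) (U x t ω) ∂P :=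
        integral_map (hm _).aemeasurable (hf.comp (measurable_centreMul c)).aestronglyMeasurable

include hU hc hflat in
/-- ★ **LUMPING: `P_t` preserves centre-invariant observables.**  If `f (c * y) = f y` for all `y` then
`P_t f (c * x) = P_t f x`: on twist-invariant measurable observables the semigroup of the SZZ dynamics descends to
configurations modulo the twist. [cite: tHooft1979Flux, §2] -/
theorem markovTransition_centreMul_of_invariant {f : GaugeConfig 3 L (Matrix.specialUnitaryGroup (Fin 2) ℂ) → ℝ}
    (hf : Measurable f) (hinv : ∀ y, f (c * y) = f y) (t : ℝ≥0)
    (x : GaugeConfig 3 L (Matrix.specialUnitaryGroup (Fin 2) ℂ)) :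
    markovTransition U P t f (c * x) = markovTransition U P t f x := by
  rw [markovTransition_centreMul β' hW hU c hc hflat hf t x]
  have hfc : (f ∘ fun y => c * y) = f := funext fun y => hinv y
  rw [hfc]

include hU hc hflat in
/-- ★ **`P_t` maps centre-odd observables to centre-odd functions.**  If `f (c * y) = −f y` for all `y` then
`P_t f (c * x) = −P_t f x`. [cite: McLerranSvetitsky1981] -/
theorem markovTransition_centreMul_of_odd {f : GaugeConfig 3 L (Matrix.specialUnitaryGroup (Fin 2) ℂ) → ℝ}
    (hf : Measurable f) (hodd : ∀ y, f (c * y) = -f y) (t : ℝ≥0)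
    (x : GaugeConfig 3 L (Matrix.specialUnitaryGroup (Fin 2) ℂ)) :
    markovTransition U P t f (c * x) = -markovTransition U P t f x := by
  rw [markovTransition_centreMul β' hW hU c hc hflat hf t x]
  have hfc : (f ∘ fun y => c * y) = fun y => -f y := funext fun y => hodd y
  rw [hfc]
  unfold markovTransition
  exact integral_neg _

end Semigroup

/-! ## §3 The 't Hooft twists are flat centre fields -/

section Twist

open Literature.MathematicalPhysics.QuantumFieldTheory.Balaban1983to89.T3ContinuumYM3Torus (negOne₂ negOne₂_comm
  negOne₂_mul_self)

variable {d : ℕ}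

/-- `ρ(−1) = −1`. [folklore] -/
theorem coe_negOne₂ : ((negOne₂ : Matrix.specialUnitaryGroup (Fin 2) ℂ) : Matrix (Fin 2) (Fin 2) ℂ) = -1 := rfl

omit [NeZero L] in
/-- **The twist field is centre valued**: the configuration `e ↦ −1` on the `μ`-links issuing from the slice `x_μ = s`,
`1` elsewhere, takes values in `{±1}`. [cite: tHooft1979Flux, §2] -/
theorem twist_centre (μ : Fin d) (s : ZMod L) (e : Edge d L) :
    (((fun e' : Edge d L => if e'.2 = μ ∧ e'.1 μ = s then negOne₂ else (1 : Matrix.specialUnitaryGroup (Fin 2) ℂ)) e :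
        Matrix.specialUnitaryGroup (Fin 2) ℂ) : Matrix (Fin 2) (Fin 2) ℂ) = 1 ∨
      (((fun e' : Edge d L => if e'.2 = μ ∧ e'.1 μ = s then negOne₂ else (1 : Matrix.specialUnitaryGroup (Fin 2) ℂ)) e :
        Matrix.specialUnitaryGroup (Fin 2) ℂ) : Matrix (Fin 2) (Fin 2) ℂ) = -1 := by
  dsimp only
  split_ifs
  · exact Or.inr coe_negOne₂
  · exact Or.inl rfl

omit [NeZero L] in
/-- The two `i`-links of a plaquette in the `(i, j)` plane see the same twist factor (`j ≠ i`: the shift by `e_j` does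
not change the `μ`-coordinate read by an `i`-link when `i = μ`, and an `i`-link with `i ≠ μ` is never twisted). [folklore] -/
theorem twist_shift_of_ne (μ : Fin d) (s : ZMod L) (x : Literature.MathematicalPhysics.QuantumFieldTheory.Site d L)
    {i j : Fin d} (hij : i ≠ j) :
    (fun e' : Edge d L => if e'.2 = μ ∧ e'.1 μ = s then negOne₂ else (1 : Matrix.specialUnitaryGroup (Fin 2) ℂ))
        (x.shift j, i) =
      (fun e' : Edge d L => if e'.2 = μ ∧ e'.1 μ = s then negOne₂ else (1 : Matrix.specialUnitaryGroup (Fin 2) ℂ))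
        (x, i) := by
  dsimp only
  by_cases hi : i = μ
  · subst hi
    have hx : (x.shift j) i = x i := by
      simp [Literature.MathematicalPhysics.QuantumFieldTheory.Site.shift, Pi.single_eq_of_ne hij]
    simp only [hx]
  · simp [hi]

omit [NeZero L] in
/-- **The twist field is flat**: every plaquette holonomy of the twist configuration is trivial (its two twisted links,
if any, contribute `(−1)(−1)⁻¹`). [cite: tHooft1979Flux, §2] -/
theorem twist_flat (μ : Fin d) (s : ZMod L) (x : Literature.MathematicalPhysics.QuantumFieldTheory.Site d L)
    (i j : Fin d) (hij : i ≠ j) :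
    plaquetteHolonomy
      (fun e' : Edge d L => if e'.2 = μ ∧ e'.1 μ = s then negOne₂ else (1 : Matrix.specialUnitaryGroup (Fin 2) ℂ))
      x i j = 1 := by
  have h1 := twist_shift_of_ne (L := L) μ s x hij
  have h2 := twist_shift_of_ne (L := L) μ s x (Ne.symm hij)
  unfold plaquetteHolonomy
  rw [h1, h2]
  -- `a b a⁻¹ b⁻¹ = 1` for the commuting centre values
  set a := (fun e' : Edge d L => if e'.2 = μ ∧ e'.1 μ = s then negOne₂ else
    (1 : Matrix.specialUnitaryGroup (Fin 2) ℂ)) (x, i) with ha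
  set b := (fun e' : Edge d L => if e'.2 = μ ∧ e'.1 μ = s then negOne₂ else
    (1 : Matrix.specialUnitaryGroup (Fin 2) ℂ)) (x, j) with hb
  have hcomm : a * b = b * a := by
    have hac : a = negOne₂ ∨ a = 1 := by
      rw [ha]; dsimp only; split_ifs
      · exact Or.inl rfl
      · exact Or.inr rfl
    rcases hac with h | h
    · rw [h]; exact negOne₂_comm b
    · rw [h, one_mul, mul_one]
  rw [hcomm, mul_inv_cancel_right, mul_inv_cancel]

variable {Ω : Type*} {mΩ : MeasurableSpace Ω} {P : Measure Ω} {𝓕 : Filtration ℝ≥0 mΩ}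
  {W : ℝ≥0 → Ω → (Edge 3 L × NoiseIdx 2 → ℝ)}

/-- ★ **The SZZ dynamics commutes with every 't Hooft twist** (direction `μ`, slice `s`): if `U` solves the system driven
by `W` then so does the twisted process `t ↦ τ_{μ,s} * U_t`, same driver, same filtration. [cite: tHooft1979Flux, §2] -/
theorem isSolution_twist (β' : ℝ) (μ : Fin 3) (s : ZMod L)
    {U : ℝ≥0 → Ω → GaugeConfig 3 L (Matrix.specialUnitaryGroup (Fin 2) ℂ)}
    (hU : (latticeLangevinDynamics (fundamentalLatticeRep 2) β').IsSolution (fundamentalRep (Fin 2)) 𝓕 P W U) :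
    (latticeLangevinDynamics (fundamentalLatticeRep 2) β').IsSolution (fundamentalRep (Fin 2)) 𝓕 P W
      (fun t ω => (fun e' : Edge 3 L => if e'.2 = μ ∧ e'.1 μ = s then negOne₂ else
        (1 : Matrix.specialUnitaryGroup (Fin 2) ℂ)) * U t ω) :=
  isSolution_centreMul β' _ (twist_centre μ s) (fun x i j hij => twist_flat μ s x i j hij) hU

/-- ★ **The Markov semigroup commutes with every 't Hooft twist**: `P_t f (τ * x) = P_t (f ∘ (τ * ·)) x` for every
solution family, every measurable `f`, every direction and slice. [cite: tHooft1979Flux, §2] -/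
theorem markovTransition_twist (β' : ℝ) {Ω : Type} {mΩ : MeasurableSpace Ω} {P : Measure Ω} [IsProbabilityMeasure P]
    {W : ℝ≥0 → Ω → (Edge 3 L × NoiseIdx 2 → ℝ)} (hW : IsFlatBrownian W P)
    {U : GaugeConfig 3 L (Matrix.specialUnitaryGroup (Fin 2) ℂ) → ℝ≥0 → Ω →
      GaugeConfig 3 L (Matrix.specialUnitaryGroup (Fin 2) ℂ)}
    (hU : ∀ x, (∀ ω, U x 0 ω = x) ∧
      (latticeLangevinDynamics (fundamentalLatticeRep 2) β').IsSolution (fundamentalRep (Fin 2))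
        hW.natFiltration P W (U x))
    (μ : Fin 3) (s : ZMod L) {f : GaugeConfig 3 L (Matrix.specialUnitaryGroup (Fin 2) ℂ) → ℝ} (hf : Measurable f)
    (t : ℝ≥0) (x : GaugeConfig 3 L (Matrix.specialUnitaryGroup (Fin 2) ℂ)) :
    markovTransition U P t f
        ((fun e' : Edge 3 L => if e'.2 = μ ∧ e'.1 μ = s then negOne₂ else
          (1 : Matrix.specialUnitaryGroup (Fin 2) ℂ)) * x) =
      markovTransition U P t
        (f ∘ fun y => (fun e' : Edge 3 L => if e'.2 = μ ∧ e'.1 μ = s then negOne₂ else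
          (1 : Matrix.specialUnitaryGroup (Fin 2) ℂ)) * y) x :=
  markovTransition_centreMul β' hW hU _ (twist_centre μ s) (fun y i j hij => twist_flat μ s y i j hij) hf t x

end Twist

end Summit.QuantumFields.YangMills.Theorems.ColdStartUniversality.CentreCovariance

end
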